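import Literature.NumberTheory.Automorphic.CuspidalRepFinWhittakerUnique
import Literature.NumberTheory.Automorphic.RestrictedTensorProductProofs
import Literature.NumberTheory.Automorphic.AutomorphicGLnFlathProofs
import HarnessLib

/-!
# The product formula `Λ(⊗'_v ξ_v) = C · ∏_v Λ_v(ξ_v)` for the `ψ_f`-Whittaker functional on the
# finite component of a cuspidal automorphic representation (Cogdell (2004), §1.2, Cor. 1.4)

Topic `NumberTheory/Automorphic`; namespace `Literature.NumberTheory.Automorphic`. Theorems only (no
definition, no named fact, no instance). Companion of `CuspidalRepFinWhittakerUnique`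
(`exists_eq_smul_of_mem_finWhittakerFunctionals`: any two `ψ_f`-Whittaker functionals on the finite
component `π_f` of a cuspidal automorphic representation of `GL_n(𝔸_K)` are proportional) and of
`WhittakerArchFinFactorization` (`W_φ = W_f · W_∞`). In print (Cogdell (2004), §1.2, proof of
Cor. 1.4: "`Λ = ⊗_v Λ_v` … Consequently, for factorizable `φ = ⊗ φ_v`,
`W_φ(g) = ∏_v W_{φ_v}(g_v)`"; Bump (1997), Thm. 3.5.2; Shalika (1974), §4) the uniqueness is
immediately followed by the **product formula**: along Flath's factorisation `π_f ≅ ⊗'_v (π_v, ξ_v°)`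
the global finite Whittaker functional is a constant multiple of the product of local ones, so that
the finite Whittaker function of a pure tensor is the product of the local Whittaker functions. This
file proves it in the tree's vocabulary:

* §1 (pure linear algebra, any restricted-multilinear `j : RestrictedFamily V x₀ → W` over a
  commutative ring): if every slot functional `y ↦ Λ (j (x.update i y))` of a linear form `Λ` on `W`
  is a multiple of a fixed local form `λ_i`, and `λ_i (e_i) = 1`, then for every finite set `S` of
  indices `Λ (j x) = Λ (j y) · ∏_{i ∈ S} λ_i (x_i)`, where `y` is `x` with the coordinates in `S`
  replaced by the `e_i` (`apply_eq_apply_mul_prod_of_slot`; with `y = extend S e` when `x` is the base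
  family off `S`, `apply_eq_apply_extend_mul_prod_of_slot`; group-action form
  `apply_rep_eq_apply_extend_mul_prod_of_slot`);
* §2 (**main**, `exists_finWhittaker_prod_formula`): for a cuspidal automorphic representation `Π` of
  `GL_n(𝔸_K)` with archimedean component `τ` (irreducible unitary, occurring in `Π`) and a NON-ZERO
  `ψ_f`-Whittaker functional `Λ₀` on `π_f = multiplicityModule hcpt τ Π` there are: Flath data on
  `π_f` (`flath_exists_holds_of_isTopologicalGroup` through `GL_n(𝔸_K^∞) ≃ Πʳ_v [GL_n(K_v), GL_n(𝒪_v)]`,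
  exactly as in the uniqueness proof: spaces `V v`, irreducible admissible `ρ_v`, base vectors `x₀ v`
  fixed by `GL_n(𝒪_v)` and with `ρ_v` spherical, `x₀ v ≠ 0` for almost all `v`, a restricted tensor
  product structure `j : RestrictedFamily V x₀ → π_f`, equivariant slot by slot and globally),
  NON-ZERO local `ψ_v`-Whittaker functionals `λ_v ∈ whittakerFunctionals (ρ v) (ψ_K)_v` (so every
  `ρ_v` is generic) and vectors `e_v` with `λ_v (e_v) = 1`, such that: every slot functional of `Λ₀`
  is a multiple of `λ_v` (local multiplicity one, `rank_whittakerFunctionals_le_one_holds`, `ψ_v`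
  non-trivial by `Tate1950_adicComponent_adeleAddChar_holds`); for every finite `S` and all restricted
  families `x`, `y` with `y = e` on `S` and `y = x` off `S`, `Λ₀ (j x) = Λ₀ (j y) · ∏_{v ∈ S} λ_v (x_v)`;
  in group form `Λ₀ (g_f · j x) = Λ₀ (j (extend S e)) · ∏_{v ∈ S} λ_v (ρ_v((e g_f)_v) x_v)` whenever
  `ρ_v((e g_f)_v) x_v = x₀ v` off `S` (the finite Whittaker FUNCTION of a pure tensor is an
  `S`-dependent constant times the product of the local Whittaker functions); `Λ₀ (j x) ≠ 0` for some
  `x`; and each Flath factor `ρ_v` IS a local component of `Π` at `v` in the `L²` sense of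
  `GLnAdelicStructure` (`HasLocalComponentAt Π v (ρ v)`: the slot map `y ↦ (j (x.update v y))(e₀)` into
  `Π ≤ L²` is a non-zero `GL_n(K_v)`-intertwiner along `GLn.ofLocal`), so that the tree's local
  invariants of `L²` local components (Satake parameters,
  `Flath1979_isSatakeParameter_of_hasLocalComponentAt_holds`; Rankin–Selberg `L`-polynomials) apply to
  the factors carrying the product formula.

Normalisation of the local functionals at the unramified places (`λ_v (x₀ v) = 1`, i.e.
non-vanishing of the spherical Whittaker function at `1` for `ψ_v` of conductor `𝒪_v`) is NOT done
here: the formula is stated with the `S`-dependent constant `Λ₀ (j y)`, valid for every finite `S`.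
Statements avoid naming `IsRestrictedTensorProductRep` for the concrete restricted product over the
finite places (its elaboration against explicitly typed binders is impractically slow); the module and
slot/global equivariance clauses are stated instead, which is all that consumers use.

## References

* J. W. Cogdell, *Lectures on L-functions, converse theorems, and functoriality for GL_n*, Fields
  Inst. Monogr. 20 (2004), §1.1–§1.2, Cor. 1.4 and its proof [CogdellAnalyticTheory2004].
* D. Bump, *Automorphic forms and representations* (1997), Thm. 3.5.2, §3.5 [Bump1997].
* J. A. Shalika, *The multiplicity one theorem for GL_n*, Ann. of Math. 100 (1974), §4.
* D. Flath, *Decomposition of representations into tensor products*, Corvallis 1979, Thm. 3.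
-/

noncomputable section

open MeasureTheory Measure NumberField NumberField.mixedEmbedding IsDedekindDomain Set Filter
open scoped MatrixGroups InnerProductSpace Classical NNReal RestrictedProduct

namespace Literature.NumberTheory.Automorphic

/-! ### 1. The abstract product formula for functionals with rank-one slots -/

section Abstract

variable {ι : Type*} {k : Type*} [CommRing k] {V : ι → Type*} [∀ i, AddCommGroup (V i)]
  [∀ i, Module k (V i)] {x₀ : ∀ i, V i} {W : Type*} [AddCommGroup W] [Module k W]
  [DecidableEq ι] {j : RestrictedFamily V x₀ → W}

omit [∀ i, AddCommGroup (V i)] [∀ i, Module k (V i)] in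
/-- For every finite set `S` of indices and every restricted family `x` there is a restricted family
agreeing with prescribed vectors `e i` on `S` and with `x` off `S` (iterate `update`). [folklore] -/
theorem RestrictedFamily.exists_eq_on_finset (S : Finset ι) (x : RestrictedFamily V x₀) (e : ∀ i, V i) :
    ∃ y : RestrictedFamily V x₀, (∀ i ∈ S, y i = e i) ∧ ∀ i ∉ S, y i = x i := by
  induction S using Finset.induction_on with
  | empty => exact ⟨x, fun i hi => absurd hi (Finset.notMem_empty i), fun i _ => rfl⟩
  | insert i S hi IH =>
    obtain ⟨y, hyS, hyx⟩ := IH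
    refine ⟨y.update i (e i), fun i' hi' => ?_, fun i' hi' => ?_⟩
    · rw [RestrictedFamily.update_apply]
      rcases Finset.mem_insert.1 hi' with rfl | h
      · rw [Function.update_self]
      · have hne : i' ≠ i := fun h' => hi (h' ▸ h)
        rw [Function.update_of_ne hne]
        exact hyS i' h
    · rw [Finset.mem_insert, not_or] at hi'
      rw [RestrictedFamily.update_apply, Function.update_of_ne hi'.1]
      exact hyx i' hi'.2

/-- **One coordinate.** If the `i`-th slot functional `y ↦ Λ (j (x.update i y))` is a multiple of
`λ_i` and `λ_i (e_i) = 1`, then `Λ (j x) = Λ (j (x.update i e_i)) · λ_i (x_i)`. [folklore] -/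
theorem apply_eq_apply_update_mul_of_slot (Λ : W →ₗ[k] k) (lam : ∀ i, Module.Dual k (V i))
    (e : ∀ i, V i) (he : ∀ i, lam i (e i) = 1)
    (hslot : ∀ (x : RestrictedFamily V x₀) (i : ι), ∃ c : k, ∀ y : V i,
      Λ (j (x.update i y)) = c * lam i y)
    (x : RestrictedFamily V x₀) (i : ι) :
    Λ (j x) = Λ (j (x.update i (e i))) * lam i (x i) := by
  obtain ⟨c, hc⟩ := hslot x i
  have h1 : Λ (j (x.update i (e i))) = c := by rw [hc, he, mul_one]
  rw [h1, ← hc, RestrictedFamily.update_eq_self]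

/-- **The abstract product formula** (the algebra of Cogdell (2004), §1.2, proof of Cor. 1.4 /
Bump (1997), Thm. 3.5.2: a multilinear functional whose partial functionals lie on prescribed lines
is a constant multiple of the product of the generators). Let `j : RestrictedFamily V x₀ → W`, `Λ` a
linear form on `W` all of whose slot functionals `y ↦ Λ (j (x.update i y))` are multiples of fixed
local forms `λ_i`, and `λ_i (e_i) = 1`. Then for every finite `S` and all restricted families `x`, `y`
with `y = e` on `S` and `y = x` off `S`: `Λ (j x) = Λ (j y) · ∏_{i ∈ S} λ_i (x_i)`.
[cite: CogdellAnalyticTheory2004, §1.2 (proof of Cor. 1.4)] -/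
theorem apply_eq_apply_mul_prod_of_slot (Λ : W →ₗ[k] k) (lam : ∀ i, Module.Dual k (V i))
    (e : ∀ i, V i) (he : ∀ i, lam i (e i) = 1)
    (hslot : ∀ (x : RestrictedFamily V x₀) (i : ι), ∃ c : k, ∀ y : V i,
      Λ (j (x.update i y)) = c * lam i y)
    (S : Finset ι) (x y : RestrictedFamily V x₀) (hyS : ∀ i ∈ S, y i = e i)
    (hyx : ∀ i ∉ S, y i = x i) :
    Λ (j x) = Λ (j y) * ∏ i ∈ S, lam i (x i) := by
  induction S using Finset.induction_on generalizing x with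
  | empty =>
    have hxy : y = x := by
      ext i
      exact hyx i (Finset.notMem_empty i)
    rw [Finset.prod_empty, mul_one, hxy]
  | insert i S hi IH =>
    have hstep := apply_eq_apply_update_mul_of_slot Λ lam e he hslot x i
    have hIH := IH (x.update i (e i)) (fun i' hi' => hyS i' (Finset.mem_insert_of_mem hi')) (fun i' hi' => by
      rw [RestrictedFamily.update_apply]
      by_cases h : i' = i
      · subst h
        rw [Function.update_self]
        exact hyS _ (Finset.mem_insert_self _ _)
      · rw [Function.update_of_ne h]
        exact hyx i' (by rw [Finset.mem_insert, not_or]; exact ⟨h, hi'⟩))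
    have hprod : ∏ i' ∈ S, lam i' ((x.update i (e i)) i') = ∏ i' ∈ S, lam i' (x i') := by
      refine Finset.prod_congr rfl fun i' hi' => ?_
      have hne : i' ≠ i := fun h => hi (h ▸ hi')
      rw [RestrictedFamily.update_apply, Function.update_of_ne hne]
    rw [hstep, hIH, hprod, Finset.prod_insert hi]
    ring

/-- **The product formula for families supported on `S`**: if `x` is the base family off `S`, the
comparison family is `extend S e` (the `e_i` on `S`, base vectors off `S`), so
`Λ (j x) = Λ (j (extend S e)) · ∏_{i ∈ S} λ_i (x_i)` — the value on a pure tensor supported on `S` is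
an `S`-dependent constant times the product of the local values.
[cite: CogdellAnalyticTheory2004, §1.2 (proof of Cor. 1.4)] -/
theorem apply_eq_apply_extend_mul_prod_of_slot (Λ : W →ₗ[k] k) (lam : ∀ i, Module.Dual k (V i))
    (e : ∀ i, V i) (he : ∀ i, lam i (e i) = 1)
    (hslot : ∀ (x : RestrictedFamily V x₀) (i : ι), ∃ c : k, ∀ y : V i,
      Λ (j (x.update i y)) = c * lam i y)
    (S : Finset ι) (x : RestrictedFamily V x₀) (hx : ∀ i ∉ S, x i = x₀ i) :
    Λ (j x) = Λ (j (RestrictedFamily.extend S fun i : S => e i)) * ∏ i ∈ S, lam i (x i) :=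
  apply_eq_apply_mul_prod_of_slot Λ lam e he hslot S x _
    (fun i hi => RestrictedFamily.extend_apply_of_mem S _ hi)
    (fun i hi => by rw [RestrictedFamily.extend_apply_of_notMem S _ hi, hx i hi])

variable {G : ι → Type*} [∀ i, Group (G i)] {K : ∀ i, Subgroup (G i)}
  {ρ : ∀ i, Representation k (G i) (V i)} {π : Representation k (Πʳ i, [G i, K i]) W}
  {hx₀ : ∀ᶠ i in cofinite, x₀ i ∈ (ρ i).fixedPoints (K i)} {S₀ : Finset ι}

/-- **Group-action form** (the finite Whittaker FUNCTION of a pure tensor is the product of the local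
Whittaker functions): in a restricted tensor product representation `(W, π, j) = ⊗'_i (ρ i, x₀ i)`,
for `g ∈ Πʳ_i [G i, K i]` and a family `x` with `ρ_i (g_i) x_i = x₀ i` off the finite set `S` (e.g.
`x` the base family and `g_i ∈ K_i` off `S ⊇ S₀`),
`Λ (π g (j x)) = Λ (j (extend S e)) · ∏_{i ∈ S} λ_i (ρ_i (g_i) x_i)`.
[cite: CogdellAnalyticTheory2004, §1.1–§1.2 ("W_φ(g) = ∏_v W_{φ_v}(g_v)")] -/
theorem apply_rep_eq_apply_extend_mul_prod_of_slot (h : IsRestrictedTensorProductRep ρ π hx₀ j S₀)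
    (Λ : W →ₗ[k] k) (lam : ∀ i, Module.Dual k (V i)) (e : ∀ i, V i) (he : ∀ i, lam i (e i) = 1)
    (hslot : ∀ (x : RestrictedFamily V x₀) (i : ι), ∃ c : k, ∀ y : V i,
      Λ (j (x.update i y)) = c * lam i y)
    (S : Finset ι) (g : Πʳ i, [G i, K i]) (x : RestrictedFamily V x₀)
    (hS : ∀ i ∉ S, ρ i (g i) (x i) = x₀ i) :
    Λ (π g (j x)) = Λ (j (RestrictedFamily.extend S fun i : S => e i)) *
      ∏ i ∈ S, lam i (ρ i (g i) (x i)) := by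
  rw [← h.map_smul]
  exact apply_eq_apply_extend_mul_prod_of_slot Λ lam e he hslot S _ (fun i hi => by
    rw [RestrictedFamily.smul_apply]; exact hS i hi)

end Abstract

/-! ### 2. The product formula for the `ψ_f`-Whittaker functional of a cuspidal representation -/

section Cuspidal

universe uE

variable {n : ℕ} {K : Type} [Field K] [NumberField K]

variable {μ : Measure (AdelicGroupData.gl n K).automorphicQuotient}
  [(AdelicGroupData.gl n K).IsAutomorphicMeasure μ]
  (hcpt : isCompact_glFiniteIntegralLevel n K)
  {E : Type uE} [NormedAddCommGroup E] [InnerProductSpace ℂ E] [CompleteSpace E]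
  {τ : ContRepresentation ℂ (AutomorphyDatum.gl n K hcpt).arch.carrier E}

omit [CompleteSpace E] in
/-- **Slot functionals of a `ψ_f`-Whittaker functional are local Whittaker functionals.** Let
`j : RestrictedFamily V x₀ → π_f` be restricted-multilinear into the finite component
`π_f = multiplicityModule hcpt τ Π` of a cuspidal `Π`, equivariant in the `v`-th slot for the action of
`GL_n(K_v)` through `e⁻¹ ∘ ι_v` (`e : GL_n(𝔸_K^∞) ≃ Πʳ_v [GL_n(K_v), GL_n(𝒪_v)]` the tree's
`GLn.restrictedPiEquiv`; this is the slot equivariance of a restricted tensor product structure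
`π_f ∘ e⁻¹ ≅ ⊗'_v (ρ_v, x₀ v)`). Then the `v`-th slot functional `y ↦ Λ (j (x.update v y))` of a
`ψ_f`-Whittaker functional `Λ` is a `(ψ_K)_v`-Whittaker functional of `ρ_v`
(`ψ_f ∘ ι_v = (ψ_v)_N` on `N_n(K_v)`). [cite: CogdellAnalyticTheory2004, §1.2 (proof of Cor. 1.4)] -/
theorem comp_slot_mem_whittakerFunctionals (P : CuspidalAutomorphicRepGL n K μ)
    {V : HeightOneSpectrum (𝓞 K) → Type*} [∀ v, AddCommGroup (V v)] [∀ v, Module ℂ (V v)]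
    {ρ : ∀ v : HeightOneSpectrum (𝓞 K), Representation ℂ (GL (Fin n) (v.adicCompletion K)) (V v)} {x₀ : ∀ v, V v}
    {j : RestrictedFamily V x₀ → multiplicityModule hcpt τ P.1} (hj : IsRestrictedMultilinear ℂ j)
    (hequiv : ∀ (x : RestrictedFamily V x₀) (v : HeightOneSpectrum (𝓞 K))
      (g : GL (Fin n) (v.adicCompletion K)) (y : V v),
      j (x.update v (ρ v g y)) = finComponentRep hcpt τ P.1 ((GLn.restrictedPiEquiv n K).symm
        (mulSingleHom (fun w : HeightOneSpectrum (𝓞 K) => glInt n (w.adicCompletion K)) v g))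
          (j (x.update v y)))
    {Λ : multiplicityModule hcpt τ P.1 →ₗ[ℂ] ℂ} (hΛ : Λ ∈ finWhittakerFunctionals hcpt τ P.1)
    (x : RestrictedFamily V x₀) (v : HeightOneSpectrum (𝓞 K)) :
    Λ ∘ₗ hj.slot x v ∈ whittakerFunctionals (ρ v) ((adeleAddChar K).adicComponent v) := by
  intro u y
  rw [LinearMap.comp_apply, LinearMap.comp_apply, IsRestrictedMultilinear.slot_apply,
    IsRestrictedMultilinear.slot_apply, hequiv x v (u : GL (Fin n) (v.adicCompletion K)) y]
  have hU := GLn.restrictedPiEquiv_symm_mulSingleHom_mem_upperUnitriangular n K v u.2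
  have h1 := (mem_finWhittakerFunctionals_iff.1 hΛ) ⟨_, hU⟩ (j (x.update v y))
  rw [finWhittakerChar_restrictedPiEquiv_symm_mulSingleHom n K v u] at h1
  exact h1

/-- If the values of `j` span `π_f` and the linear form `Λ₀` is non-zero, then `Λ₀ (j x) ≠ 0` for
some restricted family `x`. [folklore] -/
theorem exists_apply_ne_zero_of_span_range_eq_top {W : Type*} [AddCommGroup W] [Module ℂ W]
    {ι : Type*} {V : ι → Type*} {x₀ : ∀ i, V i}
    {j : RestrictedFamily V x₀ → W} (hspan : Submodule.span ℂ (Set.range j) = ⊤)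
    {Λ₀ : W →ₗ[ℂ] ℂ} (hne : Λ₀ ≠ 0) : ∃ x : RestrictedFamily V x₀, Λ₀ (j x) ≠ 0 := by
  by_contra h
  push Not at h
  exact hne (LinearMap.ext_on_range hspan fun x => by rw [LinearMap.zero_apply]; exact h x)

/-- **The product formula `Λ₀ = C · ⊗'_v λ_v` for the `ψ_f`-Whittaker functional on the finite
component of a cuspidal automorphic representation** (Cogdell (2004), §1.2, proof of Cor. 1.4: "by the
local uniqueness … `Λ = ⊗_v Λ_v`", with its consequence "`W_φ(g) = ∏_v W_{φ_v}(g_v)` for factorizable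
`φ`"; Bump (1997), Thm. 3.5.2; Shalika (1974), §4). Let `Π ≤ L²_cusp(GL_n(K) A_G \ GL_n(𝔸_K))` be
cuspidal with archimedean component `τ` (irreducible, unitary, occurring in `Π`) and let `Λ₀ ≠ 0` be a
`ψ_f`-Whittaker functional on `π_f = multiplicityModule hcpt τ Π`. Then there are Flath data on `π_f`
— vector spaces `V v`, irreducible admissible representations `ρ_v` of `GL_n(K_v)`, base vectors
`x₀ v`, `GL_n(𝒪_v)`-fixed for almost all `v`, with `ρ_v` spherical and `x₀ v ≠ 0` for almost all `v`,
and a restricted tensor product structure `j : RestrictedFamily V x₀ → π_f` (the `j x` are the pure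
tensors `⊗'_v x_v`), equivariant slot by slot (`j (x.update v (ρ_v(g) y)) = (e⁻¹ ι_v g) · j (x.update v y)`)
and globally (`g_f · j x = j (g_f • x)`, `(g_f • x)_v = ρ_v((e g_f)_v) x_v`) —, NON-ZERO local
Whittaker functionals `λ_v ∈ Hom_{N_n(K_v)}(ρ_v, (ψ_K)_v)` (every local factor is generic) and vectors
`e_v` with `λ_v (e_v) = 1`, such that:

* every slot functional of `Λ₀` is a multiple of `λ_v`: `Λ₀ (j (x.update v y)) = c · λ_v (y)`;
* **product formula**: for every finite `S` and restricted families `x`, `y` with `y = e` on `S` and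
  `y = x` off `S`, `Λ₀ (j x) = Λ₀ (j y) · ∏_{v ∈ S} λ_v (x_v)`; in group form, for `g_f ∈ GL_n(𝔸_K^∞)`
  and `x` with `ρ_v((e g_f)_v) x_v = x₀ v` off `S`,
  `Λ₀ (g_f · j x) = Λ₀ (j (extend S e)) · ∏_{v ∈ S} λ_v (ρ_v((e g_f)_v) x_v)` — the finite Whittaker
  function of a pure tensor is an `S`-dependent constant times the product of local Whittaker functions;
* **non-degeneracy**: `Λ₀ (j x) ≠ 0` for some `x`;
* **local components**: every `ρ_v` is a local component of `Π` at `v` in the `L²` sense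
  (`HasLocalComponentAt Π v (ρ v)`, `GLnAdelicStructure`).

[cite: CogdellAnalyticTheory2004, §1.2 (proof of Cor. 1.4)] -/
theorem exists_finWhittaker_prod_formula (P : CuspidalAutomorphicRepGL n K μ)
    (hτu : τ.IsUnitary) (hτi : τ.IsTopIrreducible) (hex : ∃ T ∈ archIntertwiners hcpt τ P.1, T ≠ 0)
    {Λ₀ : multiplicityModule hcpt τ P.1 →ₗ[ℂ] ℂ} (hΛ₀ : Λ₀ ∈ finWhittakerFunctionals hcpt τ P.1)
    (hne : Λ₀ ≠ 0) :
    ∃ (V : HeightOneSpectrum (𝓞 K) → Type uE) (_ : ∀ v, AddCommGroup (V v)) (_ : ∀ v, Module ℂ (V v))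
      (ρ : ∀ v : HeightOneSpectrum (𝓞 K), Representation ℂ (GL (Fin n) (v.adicCompletion K)) (V v)) (x₀ : ∀ v, V v)
      (j : RestrictedFamily V x₀ → multiplicityModule hcpt τ P.1) (S₀ : Finset (HeightOneSpectrum (𝓞 K)))
      (lam : ∀ v, Module.Dual ℂ (V v)) (e : ∀ v, V v),
      -- Flath data
      (∀ v, (ρ v).IsIrreducible ∧ (ρ v).IsAdmissible) ∧
      (∀ᶠ v in cofinite, x₀ v ∈ (ρ v).fixedPoints (glInt n (v.adicCompletion K))) ∧
      (∀ᶠ v in cofinite, (ρ v).IsSpherical (glInt n (v.adicCompletion K)) ∧ x₀ v ≠ 0) ∧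
      IsRestrictedTensorProduct ℂ j S₀ ∧
      (∀ (x : RestrictedFamily V x₀) (v : HeightOneSpectrum (𝓞 K)) (g : GL (Fin n) (v.adicCompletion K))
        (y : V v), j (x.update v (ρ v g y)) = finComponentRep hcpt τ P.1 ((GLn.restrictedPiEquiv n K).symm
          (mulSingleHom (fun w : HeightOneSpectrum (𝓞 K) => glInt n (w.adicCompletion K)) v g))
            (j (x.update v y))) ∧
      (∀ (gf : GL (Fin n) (FiniteAdeleRing (𝓞 K) K)) (x : RestrictedFamily V x₀),
        ∃ x' : RestrictedFamily V x₀, (∀ v, x' v = ρ v (GLn.restrictedPiEquiv n K gf v) (x v)) ∧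
          j x' = finComponentRep hcpt τ P.1 gf (j x)) ∧
      -- local Whittaker functionals and the product formula
      (∀ v, lam v ∈ whittakerFunctionals (ρ v) ((adeleAddChar K).adicComponent v)) ∧
      (∀ v, lam v ≠ 0) ∧ (∀ v, lam v (e v) = 1) ∧
      (∀ (x : RestrictedFamily V x₀) (v : HeightOneSpectrum (𝓞 K)), ∃ c : ℂ, ∀ y : V v,
        Λ₀ (j (x.update v y)) = c * lam v y) ∧
      (∀ (S : Finset (HeightOneSpectrum (𝓞 K))) (x y : RestrictedFamily V x₀),
        (∀ v ∈ S, y v = e v) → (∀ v ∉ S, y v = x v) → Λ₀ (j x) = Λ₀ (j y) * ∏ v ∈ S, lam v (x v)) ∧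
      (∀ (S : Finset (HeightOneSpectrum (𝓞 K))) (gf : GL (Fin n) (FiniteAdeleRing (𝓞 K) K))
        (x : RestrictedFamily V x₀), (∀ v ∉ S, ρ v (GLn.restrictedPiEquiv n K gf v) (x v) = x₀ v) →
        Λ₀ (finComponentRep hcpt τ P.1 gf (j x)) =
          Λ₀ (j (RestrictedFamily.extend S fun v : S => e v)) *
            ∏ v ∈ S, lam v (ρ v (GLn.restrictedPiEquiv n K gf v) (x v))) ∧
      (∃ x : RestrictedFamily V x₀, Λ₀ (j x) ≠ 0) ∧
      -- local components in the `L²` sense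
      (∀ v, HasLocalComponentAt P.1 v (ρ v)) := by
  -- Step 1: `π_f` transported to the restricted product is irreducible admissible
  set ρf := finComponentRep hcpt τ P.1 with hρf
  haveI hirr : ρf.IsIrreducible := isIrreducible_finComponentRep hcpt P hτu hτi hex
  have hadm : ρf.IsAdmissible :=
    isAdmissible_finComponentRep (hcpt := hcpt) (τ := τ) P.le_cuspidalSubspace hτu hτi
  set eqv := GLn.restrictedPiEquiv n K with heqv
  set π' : Representation ℂ
      (Πʳ w : HeightOneSpectrum (𝓞 K), [GL (Fin n) (w.adicCompletion K), glInt n (w.adicCompletion K)])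
      (multiplicityModule hcpt τ P.1) := ρf.comp eqv.symm.toMonoidHom with hπ'
  haveI hirr' : π'.IsIrreducible :=
    isIrreducible_comp_of_surjective ρf eqv.symm.toMonoidHom eqv.symm.surjective
  have hadm' : π'.IsAdmissible :=
    IsAdmissible.comp_of_isOpenMap ρf eqv.symm.toMonoidHom GLn.continuous_restrictedPiEquiv_symm
      GLn.isOpenMap_restrictedPiEquiv_symm hadm
  -- Step 2: Flath's theorem
  have hGP : ∀ᶠ w : HeightOneSpectrum (𝓞 K) in cofinite,
      IsGelfandPair ℂ (GL (Fin n) (w.adicCompletion K)) (glInt n (w.adicCompletion K)) :=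
    Eventually.of_forall fun w => SatakeParametersGL.isGelfandPair_glInt_holds n (w.adicCompletion K)
  obtain ⟨V, _, _, ρ, x₀, hx₀, j, S₀, hrtp, hρ, hsph⟩ :=
    flath_exists_holds_of_isTopologicalGroup (ι := HeightOneSpectrum (𝓞 K))
      (G := fun w => GL (Fin n) (w.adicCompletion K)) (K := fun w => glInt n (w.adicCompletion K))
      (W := multiplicityModule hcpt τ P.1)
      (fun w => isOpen_glInt n (w.adicCompletion K)) (fun w => isCompact_glInt n (w.adicCompletion K)) hGP
      π' hirr' hadm'
  have hj : IsRestrictedMultilinear ℂ j := hrtp.isRestrictedTensorProduct.isRestrictedMultilinear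
  -- Step 3: equivariance, slot by slot and globally
  have hequiv : ∀ (x : RestrictedFamily V x₀) (v : HeightOneSpectrum (𝓞 K))
      (g : GL (Fin n) (v.adicCompletion K)) (y : V v),
      j (x.update v (ρ v g y)) = finComponentRep hcpt τ P.1 (eqv.symm
        (mulSingleHom (fun w : HeightOneSpectrum (𝓞 K) => glInt n (w.adicCompletion K)) v g))
          (j (x.update v y)) := fun x v g y => by
    rw [hrtp.apply_update_apply, ← mulSingleHom_apply]
    rfl
  have hglob : ∀ (gf : GL (Fin n) (FiniteAdeleRing (𝓞 K) K)) (x : RestrictedFamily V x₀),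
      ∃ x' : RestrictedFamily V x₀, (∀ v, x' v = ρ v (eqv gf v) (x v)) ∧
        j x' = finComponentRep hcpt τ P.1 gf (j x) := fun gf x => by
    refine ⟨RestrictedFamily.smul ρ hx₀ (eqv gf) x, fun v => rfl, ?_⟩
    rw [hrtp.map_smul]
    change ρf (eqv.symm (eqv gf)) (j x) = _
    rw [MulEquiv.symm_apply_apply]
  -- Step 4: the slot functionals are local Whittaker functionals, on a line (local multiplicity one)
  have hψ : ∀ w : HeightOneSpectrum (𝓞 K), ((adeleAddChar K).adicComponent w).IsContinuousNontrivial :=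
    fun w => (isGlobalAddChar_adeleAddChar K).isContinuousNontrivial_adicComponent
      ((Tate1950_adicComponent_adeleAddChar_holds K).1 w)
  have hslotW : ∀ (x : RestrictedFamily V x₀) (w : HeightOneSpectrum (𝓞 K)),
      Λ₀ ∘ₗ hj.slot x w ∈ whittakerFunctionals (ρ w) ((adeleAddChar K).adicComponent w) := fun x w =>
    comp_slot_mem_whittakerFunctionals hcpt P hj hequiv hΛ₀ x w
  have hrank : ∀ w : HeightOneSpectrum (𝓞 K),
      Module.rank ℂ (whittakerFunctionals (ρ w) ((adeleAddChar K).adicComponent w)) ≤ 1 := fun w => by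
    haveI := (hρ w).1
    exact rank_whittakerFunctionals_le_one_holds (ρ w) ((adeleAddChar K).adicComponent w)
      (hρ w).2.isSmooth (hψ w)
  -- Step 5: non-degeneracy, and a non-zero slot functional at every place
  have hnondeg : ∃ x : RestrictedFamily V x₀, Λ₀ (j x) ≠ 0 :=
    exists_apply_ne_zero_of_span_range_eq_top hrtp.isRestrictedTensorProduct.span_range_eq_top hne
  obtain ⟨xg, hxg⟩ := hnondeg
  have hslot_ne : ∀ w, Λ₀ ∘ₗ hj.slot xg w ≠ 0 := fun w h => by
    apply hxg
    have h1 : Λ₀ (j xg) = (Λ₀ ∘ₗ hj.slot xg w) (xg w) := by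
      rw [LinearMap.comp_apply, IsRestrictedMultilinear.slot_apply, RestrictedFamily.update_eq_self]
    rw [h1, h, LinearMap.zero_apply]
  -- the local functionals `λ_w` and the normalising vectors `e_w`
  let lam : ∀ w, Module.Dual ℂ (V w) := fun w => Λ₀ ∘ₗ hj.slot xg w
  have hlamW : ∀ w, lam w ∈ whittakerFunctionals (ρ w) ((adeleAddChar K).adicComponent w) :=
    fun w => hslotW xg w
  have hlam_ne : ∀ w, lam w ≠ 0 := hslot_ne
  have hexe : ∀ w, ∃ y : V w, lam w y = 1 := fun w => by
    obtain ⟨y, hy⟩ : ∃ y, lam w y ≠ 0 := by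
      by_contra h
      push Not at h
      exact hlam_ne w (LinearMap.ext h)
    exact ⟨(lam w y)⁻¹ • y, by rw [map_smul, smul_eq_mul, inv_mul_cancel₀ hy]⟩
  choose e he using hexe
  have hslot : ∀ (x : RestrictedFamily V x₀) (w : HeightOneSpectrum (𝓞 K)), ∃ c : ℂ, ∀ y : V w,
      Λ₀ (j (x.update w y)) = c * lam w y := fun x w => by
    obtain ⟨c, hc⟩ := exists_eq_smul_of_rank_le_one
      (whittakerFunctionals (ρ w) ((adeleAddChar K).adicComponent w)) (hrank w)
      (hlamW w) (hslotW x w) (hlam_ne w)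
    refine ⟨c, fun y => ?_⟩
    have h1 := LinearMap.congr_fun hc y
    rw [LinearMap.comp_apply, IsRestrictedMultilinear.slot_apply, LinearMap.smul_apply, smul_eq_mul] at h1
    exact h1
  -- Step 6: local components in the `L²` sense
  have hloc : ∀ v, HasLocalComponentAt P.1 v (ρ v) := fun v => by
    -- an archimedean vector where the pure tensor `j xg` does not vanish
    have hjxg : (j xg : multiplicityModule hcpt τ P.1) ≠ 0 := fun h => hxg (by rw [h, map_zero])
    obtain ⟨e₀, he₀⟩ : ∃ e₀ : E, ((j xg : multiplicityModule hcpt τ P.1) : E →L[ℂ] (AdelicGroupData.gl n K).L2 μ) e₀ ≠ 0 := by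
      by_contra h
      push Not at h
      exact hjxg (Subtype.ext (ContinuousLinearMap.ext h))
    -- the slot map `y ↦ (j (xg.update v y)) e₀`
    let f : V v →ₗ[ℂ] P.1.toSubmodule :=
      { toFun := fun y => ⟨((j (xg.update v y) : multiplicityModule hcpt τ P.1) :
            E →L[ℂ] (AdelicGroupData.gl n K).L2 μ) e₀,
          (mem_archIntertwiners_of_mem_multiplicityModule (j (xg.update v y)).2).1 e₀⟩
        map_add' := fun y y' => Subtype.ext (by
          change ((j (xg.update v (y + y')) : multiplicityModule hcpt τ P.1) : E →L[ℂ] (AdelicGroupData.gl n K).L2 μ) e₀ =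
            ((j (xg.update v y) : multiplicityModule hcpt τ P.1) : E →L[ℂ] (AdelicGroupData.gl n K).L2 μ) e₀ +
              ((j (xg.update v y') : multiplicityModule hcpt τ P.1) : E →L[ℂ] (AdelicGroupData.gl n K).L2 μ) e₀
          rw [hj.map_update_add, Submodule.coe_add, _root_.add_apply])
        map_smul' := fun c y => Subtype.ext (by
          change ((j (xg.update v (c • y)) : multiplicityModule hcpt τ P.1) : E →L[ℂ] (AdelicGroupData.gl n K).L2 μ) e₀ =
            c • ((j (xg.update v y) : multiplicityModule hcpt τ P.1) : E →L[ℂ] (AdelicGroupData.gl n K).L2 μ) e₀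
          rw [hj.map_update_smul, Submodule.coe_smul, _root_.smul_apply]) }
    have hf : ∀ y, ((f y : P.1.toSubmodule) : (AdelicGroupData.gl n K).L2 μ) =
        ((j (xg.update v y) : multiplicityModule hcpt τ P.1) : E →L[ℂ] (AdelicGroupData.gl n K).L2 μ) e₀ :=
      fun y => rfl
    refine ⟨f, fun h => he₀ ?_, fun g y => Subtype.ext ?_⟩
    · have h1 := congrArg (fun F : V v →ₗ[ℂ] P.1.toSubmodule => ((F (xg v) : P.1.toSubmodule) :
        (AdelicGroupData.gl n K).L2 μ)) h
      simp only [LinearMap.zero_apply, Submodule.coe_zero] at h1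
      rw [hf, RestrictedFamily.update_eq_self] at h1
      exact h1
    · rw [ContRepresentation.ClosedSubrep.coe_toContRep_apply, hf, hf, hequiv, coe_finComponentRep_apply,
        ContinuousLinearMap.comp_apply, GLn.ofFinite_restrictedPiEquiv_symm_mulSingleHom]
  -- Step 7: assembly
  refine ⟨V, inferInstance, inferInstance, ρ, x₀, j, S₀, lam, e, hρ, hx₀, hsph,
    hrtp.isRestrictedTensorProduct, hequiv, hglob, hlamW, hlam_ne, he, hslot,
    fun S x y hyS hyx => apply_eq_apply_mul_prod_of_slot Λ₀ lam e he hslot S x y hyS hyx,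
    fun S gf x hS => ?_, ⟨xg, hxg⟩, hloc⟩
  obtain ⟨x', hx', hjx'⟩ := hglob gf x
  have hprod := apply_eq_apply_extend_mul_prod_of_slot Λ₀ lam e he hslot S x'
    (fun v hv => (hx' v).trans (hS v hv))
  have h2 : Λ₀ (finComponentRep hcpt τ P.1 gf (j x)) = Λ₀ (j x') := congrArg Λ₀ hjx'.symm
  exact h2.trans (hprod.trans (congrArg (fun t => Λ₀ (j (RestrictedFamily.extend S fun v : S => e v)) * t)
    (Finset.prod_congr rfl fun v _ => congrArg (lam v) (hx' v))))

end Cuspidal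

end Literature.NumberTheory.Automorphic

end
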